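import Summits.AtomisticToContinuum.Crystallization.Theorems.AperiodicFrustratedLawGap.Negative.OffAtlasCapCeiling
import Summits.AtomisticToContinuum.Crystallization.Theorems.OnePercentCertificate.Negative.TwoConeSABound

/-!
# FrustratedLawDichotomy · crux `AperiodicFrustratedLawGap` (stmt-AtomisticToContinuum-27623) — NEGATIVE: the cap-dial ceiling WITH THE FLOOR OF RECORD
# (decomp-a2c, lens-5 g117; companion of `…Negative.OffAtlasCapCeiling`)

`OffAtlasCapCeiling` fences (404)'s deficit-cap dial parametrically in a certified floor `L ≤ e⋆`.  This companion plugs in the tree's floor of record,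
`L₂ = −98309653/125000000 ≈ −0.786477` — the two-cone positive-type certificate `…OnePercentCertificate.Negative.TwoConeSABound`
(`TwoConeSA.twoConeS_groundStateEnergy_ge : E(N) ≥ L₂·N`) combined with the proved energy limit `crysEnergyLimit : E(N)/N → e⋆` (in the cone of (404)) —
and states the UNCONDITIONAL numbers:
* `twoConeFloor_le_eStar : L₂ ≤ e⋆` (the 6-line derivation of `…PhononSlackCertificatesNearFarGlueRHoles.neg_twoCone_le_eStar`, re-derived so that the only
  cross-crux import is the certificate itself — shared NEGATIVE infrastructure of the summit, not a route theorem);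
* `capFloor = L₂ + 2799/2000 = 76627847/125000000 ≈ 0.6130 > 3/5`; ★★ `capFloor_le_cap`: EVERY cap `D` admissible in (404)'s slot `hcap` has `D ≥ 0.613`;
  `not_cap_three_fifths`, ★ `not_sitewise_gap_univ`: the sitewise gap «rootEnergy ≥ e⋆ on rooted 7/10-hard-core configurations» is FALSE outright;
* ★★ `reach_F1_lt`: with the class-A margin of record `m_A(F1) = 5057/10⁶`, `reach m D < 1/119` for EVERY admissible cap — against (404)'s certified
  `reach m D_univ > 1/40000` and g116's `reach m 5 ≈ 1.01·10⁻³`: the whole remaining headroom of the dial is a factor `< 8.3`, all of it below `0.85 %` of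
  off-atlas mass; `reach_bulk_lt`: even a bulk-size margin `m = 31/1000` caps below `1/20`.  THE RESIDUAL A(η) MUST BE CARRIED FOR EVERY `η ≥ 1/119`
  (resp. `≥ 1/20`) BY AN INSTRUMENT THAT IS NOT A SITEWISE CAP — the typed form of «A carries the whole difficulty» for the lens-5 regime split.
DEFS `twoConeFloor capFloor` (plain); imports `…Negative.OffAtlasCapCeiling` (own crux) + the certificate `…TwoConeSABound`; 0 sorry.
-/

noncomputable section

namespace Summit.AtomisticToContinuum.Crystallization.Theorems.AperiodicFrustratedLawGap.Negative.OffAtlasCapCeilingTwoCone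

open MeasureTheory
open Literature.MathematicalPhysics.StatisticalMechanics Literature.Probability.Process
open Summit.AtomisticToContinuum.Crystallization.Theorems.ChargedEnergyGapNegative (E3 eStar crysEnergyLimit)
open Summit.AtomisticToContinuum.Crystallization.Theorems.FrustratedLawDichotomyAtlasReach
open Summit.AtomisticToContinuum.Crystallization.Theorems.AperiodicFrustratedLawGap.Negative.OffAtlasCapCeiling

/-- The two-cone floor constant `L₂ = −98309653/125000000 ≈ −0.786477`. [folklore] -/
def twoConeFloor : ℝ := -(98309653 / 125000000)

/-- ★ The floor of record: `L₂ ≤ e⋆`, from `E(N) ≥ L₂·N` (`TwoConeSA`) and `E(N)/N → e⋆` (`crysEnergyLimit`). [folklore] -/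
theorem twoConeFloor_le_eStar : twoConeFloor ≤ eStar :=
  ge_of_tendsto crysEnergyLimit (Filter.eventually_atTop.2 ⟨1, fun N hN => by
    have h := TwoConeSA.twoConeS_groundStateEnergy_ge N
    have hN' : (0 : ℝ) < N := by exact_mod_cast hN
    rw [twoConeFloor, le_div_iff₀ hN']
    linarith⟩)

/-- The certified floor UNDER the cap dial: `capFloor := L₂ + 2799/2000`. [new: bookkeeping] -/
def capFloor : ℝ := twoConeFloor + 2799 / 2000

/-- `capFloor = 76627847/125000000 ≈ 0.61302`. [new: bookkeeping] -/
theorem capFloor_eq : capFloor = 76627847 / 125000000 := by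
  rw [capFloor, twoConeFloor]; norm_num

/-- `3/5 < capFloor`. [new: bookkeeping] -/
theorem three_fifths_lt_capFloor : 3 / 5 < capFloor := by
  rw [capFloor_eq]; norm_num

/-- The witness's own deficit: `e⋆ − rootEnergy(cluster) ≥ capFloor > 0.613`. [new: negative] -/
theorem capFloor_le_deficit_cluster : capFloor ≤ eStar - rootEnergy lennardJones clusterMeasure := by
  have h1 := twoConeFloor_le_eStar
  have h2 := rootEnergy_cluster_le
  rw [capFloor]
  linarith

/-- ★★ THE CAP FLOOR, unconditionally: every deficit cap admissible in (404)'s slot has `D ≥ capFloor > 0.613`. [new: negative] -/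
theorem capFloor_le_cap {D : ℝ} (hcap : ∀ μ : Measure E3, IsRootedHardCore (7 / 10) μ → eStar - rootEnergy lennardJones μ ≤ D) : capFloor ≤ D :=
  floor_add_le_cap twoConeFloor_le_eStar hcap

/-- No cap below `capFloor` is certifiable. [new: negative] -/
theorem not_cap_lt_capFloor {D : ℝ} (hD : D < capFloor) :
    ¬ ∀ μ : Measure E3, IsRootedHardCore (7 / 10) μ → eStar - rootEnergy lennardJones μ ≤ D :=
  not_cap_lt twoConeFloor_le_eStar hD

/-- In particular `D = 3/5` is not an admissible cap ((404)'s hoped-for `D♯ ≈ 1` was the right order, `D♯ < 0.613` is impossible). [new: negative] -/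
theorem not_cap_three_fifths : ¬ ∀ μ : Measure E3, IsRootedHardCore (7 / 10) μ → eStar - rootEnergy lennardJones μ ≤ 3 / 5 :=
  not_cap_lt_capFloor three_fifths_lt_capFloor

/-- ★ THE SITEWISE GAP IS FALSE: some rooted `7/10`-hard-core configuration has root energy `< e⋆`. [new: negative] -/
theorem not_sitewise_gap_univ : ¬ ∀ μ : Measure E3, IsRootedHardCore (7 / 10) μ → eStar ≤ rootEnergy lennardJones μ :=
  not_sitewise_gap twoConeFloor_le_eStar (by rw [twoConeFloor]; norm_num)

/-- ★★ THE REACH CEILING, unconditionally: `reach m D ≤ reach m capFloor` for every admissible cap. [new: negative] -/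
theorem reach_le_reach_capFloor {D m : ℝ} (hm : 0 < m)
    (hcap : ∀ μ : Measure E3, IsRootedHardCore (7 / 10) μ → eStar - rootEnergy lennardJones μ ≤ D) : reach m D ≤ reach m capFloor :=
  reach_le_ceiling hm twoConeFloor_le_eStar (by rw [twoConeFloor]; norm_num) hcap

/-- … and `reach m capFloor ≤ reach m (3/5)`. [new: bookkeeping] -/
theorem reach_capFloor_le {m : ℝ} (hm : 0 < m) : reach m capFloor ≤ reach m (3 / 5) :=
  reach_anti hm (by norm_num) three_fifths_lt_capFloor.le

/-- `reach(m_A(F1), 3/5) < 1/119` (`≈ 0.836 %`). [new: bookkeeping] -/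
theorem reach_F1_ceiling : reach (5057 / 1000000) (3 / 5) < 1 / 119 := by
  rw [reach]; norm_num

/-- ★★ NUMERIC CEILING at the class-A margin of record: for EVERY admissible cap, `reach (5057/10⁶) D < 1/119` — the reach theorem with the F1 margin can never
exclude a law with off-atlas mass `≥ 0.85 %`. [new: negative] -/
theorem reach_F1_lt {D : ℝ} (hcap : ∀ μ : Measure E3, IsRootedHardCore (7 / 10) μ → eStar - rootEnergy lennardJones μ ≤ D) :
    reach (5057 / 1000000) D < 1 / 119 :=
  lt_of_le_of_lt ((reach_le_reach_capFloor (by norm_num) hcap).trans (reach_capFloor_le (by norm_num))) reach_F1_ceiling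

/-- Even a bulk-size margin `m = 31/1000` leaves the ceiling below `5 %`: `reach (31/1000) D < 1/20` for every admissible cap. [new: negative] -/
theorem reach_bulk_lt {D : ℝ} (hcap : ∀ μ : Measure E3, IsRootedHardCore (7 / 10) μ → eStar - rootEnergy lennardJones μ ≤ D) :
    reach (31 / 1000) D < 1 / 20 :=
  lt_of_le_of_lt ((reach_le_reach_capFloor (by norm_num) hcap).trans (reach_capFloor_le (by norm_num))) (by rw [reach]; norm_num)

end Summit.AtomisticToContinuum.Crystallization.Theorems.AperiodicFrustratedLawGap.Negative.OffAtlasCapCeilingTwoCone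

end
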